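import Summits.Ventures.QEC.Census.Bits
import Summits.Ventures.QEC.Census.CertBits
import HarnessLib

/-!
# Packed bit representation II — completeness of row combinations and rank tests on numerals

Venture QEC (cell `qec`), checker-side plumbing continuing `Census/Bits.lean` (PARTITION row 01,
v2 D2.4): for a family of row numerals `rows : Fin m → ℕ` (CSS side) or of numeral PAIRS
`(xs r | zs r)` (additive / non-CSS side, rows of Gottesman's binary matrix `(A|B)`), the
`𝔽₂`-combinations are exactly the words `ofBits n (xorRows rows c)` (resp. pairs
`(xorRows xs c | xorRows zs c)`) for coefficient numerals `c < 2ᵐ`. Hence the brute-force tests a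
kernel-evaluated checker runs on numerals decide the abstract notions:

* `mem_span_range_ofBits_iff` / `exists_vecMul_ofBitRows_iff` — row-space membership ↔ the
  `2ᵐ`-table test; `mem_span_range_ofBitPair_iff` — stabilizer-span membership for pairs;
* `linearIndependent_ofBits_iff` / `linearIndependent_ofBitPair_iff` — independence (hence rank,
  hence `k`) ↔ "no nonzero `c < 2ᵐ` xors the rows to zero";
* helpers `ofBits_eq_zero_iff`, `xorRows_lt`, `ofBitPair_eq_zero_iff` (numerals `< 2ⁿ`);
* GLUE with the checker's own copies in `Census/CertBits.lean` (type-10, namespace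
  `Summit.Ventures.QEC.Census`, definitionally the same functions; `Census.ofBits = ofBits` is
  `rfl`, named `Decoders.census_ofBits_eq` in type-08's `RadiusCheck.lean`):
  `census_popc_eq_bitCount`, `census_rowMatrix_eq_ofBitRows`, `census_synZero_iff_mulVec` — so
  every lemma of `Bits.lean` / this file applies to `checkDistCert`'s data and conversely.

Elementary ("folklore"); no instances, no notation.
-/

namespace Summit.Ventures.QEC

open Literature.InformationTheory.QuantumCodes Matrix Finset

variable {n m : ℕ}

/-! ### Completeness of row combinations; rank tests on numerals -/

/-- `ofBits n w = 0 ↔ w = 0` for numerals `w < 2ⁿ`. [folklore] -/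
theorem ofBits_eq_zero_iff {w : ℕ} (hw : w < 2 ^ n) : ofBits n w = 0 ↔ w = 0 :=
  ⟨fun h => ofBits_inj hw (Nat.two_pow_pos n) (h.trans (ofBits_zero n).symm),
    fun h => h ▸ ofBits_zero n⟩

/-- The xor of rows `< 2ⁿ` is `< 2ⁿ`. [folklore] -/
theorem xorRows_lt : ∀ {m : ℕ} (rows : Fin m → ℕ), (∀ r, rows r < 2 ^ n) → ∀ c, xorRows rows c < 2 ^ n
  | 0, _, _, _ => Nat.two_pow_pos n
  | _ + 1, rows, h, c => by
    rw [xorRows]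
    refine Nat.xor_lt_two_pow ?_ (xorRows_lt _ (fun r => h r.succ) _)
    split
    · exact h 0
    · exact Nat.two_pow_pos n

/-- Every `𝔽₂`-combination `y ᵥ* H` of the rows is the word of `xorRows rows (toBits y)`: scanning the
numerals `c < 2ᵐ` visits the whole row space. Column: proved. [folklore] -/
theorem vecMul_ofBitRows_eq_ofBits_xorRows (rows : Fin m → ℕ) (y : Fin m → ZMod 2) :
    y ᵥ* ofBitRows n rows = ofBits n (xorRows rows (toBits y)) := by
  rw [ofBits_xorRows_eq_vecMul, ofBits_toBits]

/-- Row-space membership on numerals: `v = y ᵥ* H` for some `y` iff `v = ofBits n (xorRows rows c)` for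
some `c < 2ᵐ`. Column: proved. [folklore] -/
theorem exists_vecMul_ofBitRows_iff (rows : Fin m → ℕ) (v : Fin n → ZMod 2) :
    (∃ y : Fin m → ZMod 2, y ᵥ* ofBitRows n rows = v) ↔ ∃ c < 2 ^ m, ofBits n (xorRows rows c) = v :=
  ⟨fun ⟨y, hy⟩ => ⟨toBits y, toBits_lt y, by rw [← vecMul_ofBitRows_eq_ofBits_xorRows]; exact hy⟩,
    fun ⟨c, _, hc⟩ => ⟨ofBits m c, by rw [← ofBits_xorRows_eq_vecMul]; exact hc⟩⟩

/-- Span membership on numerals: `v ∈ span {rows}` iff `v = ofBits n (xorRows rows c)` for some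
`c < 2ᵐ` (the `2ᵐ`-table test of a brute-force checker). Column: proved. [folklore] -/
theorem mem_span_range_ofBits_iff (rows : Fin m → ℕ) (v : Fin n → ZMod 2) :
    v ∈ Submodule.span (ZMod 2) (Set.range fun r => ofBits n (rows r)) ↔
      ∃ c < 2 ^ m, ofBits n (xorRows rows c) = v := by
  rw [Submodule.mem_span_range_iff_exists_fun]
  constructor
  · rintro ⟨y, hy⟩
    exact ⟨toBits y, toBits_lt y, by rw [ofBits_xorRows, ofBits_toBits]; exact hy⟩
  · rintro ⟨c, -, hc⟩
    exact ⟨ofBits m c, by rw [← ofBits_xorRows]; exact hc⟩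

/-- **Rank test on numerals**: the rows are linearly independent iff no nonzero coefficient numeral
`c < 2ᵐ` xors them to the zero word. Column: proved. [folklore] -/
theorem linearIndependent_ofBits_iff (rows : Fin m → ℕ) :
    LinearIndependent (ZMod 2) (fun r => ofBits n (rows r)) ↔
      ∀ c < 2 ^ m, ofBits n (xorRows rows c) = 0 → c = 0 := by
  rw [Fintype.linearIndependent_iff]
  constructor
  · intro h c hc h0
    have hy : ∀ i, ofBits m c i = 0 := h (ofBits m c) (by rw [← ofBits_xorRows]; exact h0)
    exact (ofBits_eq_zero_iff hc).1 (funext hy)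
  · intro h y hy i
    have hc := h (toBits y) (toBits_lt y) (by rw [ofBits_xorRows, ofBits_toBits]; exact hy)
    have : y = 0 := by rw [← ofBits_toBits y, hc, ofBits_zero]
    rw [this, Pi.zero_apply]

/-- Combinations of symplectic pairs: the pair of xors is `Σ_r c_r · (xs r | zs r)`. Column: proved.
[cite: Gottesman1997, §3.4 ("Multiplication of group elements corresponds to addition of the corresponding binary vectors")] -/
theorem ofBitPair_xorRows (xs zs : Fin m → ℕ) (c : ℕ) :
    ofBitPair n (xorRows xs c) (xorRows zs c) = ∑ r : Fin m, ofBits m c r • ofBitPair n (xs r) (zs r) := by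
  refine Prod.ext ?_ ?_
  · rw [ofBitPair_fst, ofBits_xorRows, Prod.fst_sum]
    simp only [Prod.smul_fst, ofBitPair_fst]
  · rw [ofBitPair_snd, ofBits_xorRows, Prod.snd_sum]
    simp only [Prod.smul_snd, ofBitPair_snd]

/-- Stabilizer-span membership on numerals (additive / non-CSS codes): `v ∈ span {(xs r | zs r)}` iff
`v = (xorRows xs c | xorRows zs c)` for some `c < 2ᵐ`. Column: proved.
[cite: Gottesman1997, §3.4 (binary matrix (A|B); "addition of the corresponding binary vectors")] -/
theorem mem_span_range_ofBitPair_iff (xs zs : Fin m → ℕ) (v : SympVec n) :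
    v ∈ Submodule.span (ZMod 2) (Set.range fun r => ofBitPair n (xs r) (zs r)) ↔
      ∃ c < 2 ^ m, ofBitPair n (xorRows xs c) (xorRows zs c) = v := by
  rw [Submodule.mem_span_range_iff_exists_fun]
  constructor
  · rintro ⟨y, hy⟩
    exact ⟨toBits y, toBits_lt y, by rw [ofBitPair_xorRows, ofBits_toBits]; exact hy⟩
  · rintro ⟨c, -, hc⟩
    exact ⟨ofBits m c, by rw [← ofBitPair_xorRows]; exact hc⟩

/-- **Rank test on numeral pairs**: the symplectic rows `(xs r | zs r)` are linearly independent iff no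
nonzero coefficient numeral `c < 2ᵐ` xors both components to zero words. Column: proved.
[cite: Gottesman1997, §3.4 (binary matrix (A|B))] -/
theorem linearIndependent_ofBitPair_iff (xs zs : Fin m → ℕ) :
    LinearIndependent (ZMod 2) (fun r => ofBitPair n (xs r) (zs r)) ↔
      ∀ c < 2 ^ m, ofBitPair n (xorRows xs c) (xorRows zs c) = 0 → c = 0 := by
  rw [Fintype.linearIndependent_iff]
  constructor
  · intro h c hc h0
    have hy : ∀ i, ofBits m c i = 0 := h (ofBits m c) (by rw [← ofBitPair_xorRows]; exact h0)
    exact (ofBits_eq_zero_iff hc).1 (funext hy)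
  · intro h y hy i
    have hc := h (toBits y) (toBits_lt y) (by rw [ofBitPair_xorRows, ofBits_toBits]; exact hy)
    have : y = 0 := by rw [← ofBits_toBits y, hc, ofBits_zero]
    rw [this, Pi.zero_apply]

/-- The pair word is zero iff both numerals are zero (for numerals `< 2ⁿ`) — the numeral form of the
two tests above. [folklore] -/
theorem ofBitPair_eq_zero_iff {xs zs : ℕ} (hx : xs < 2 ^ n) (hz : zs < 2 ^ n) :
    ofBitPair n xs zs = 0 ↔ xs = 0 ∧ zs = 0 := by
  rw [ofBitPair, Prod.mk_eq_zero, ofBits_eq_zero_iff hx, ofBits_eq_zero_iff hz]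

/-! ### Glue with the checker's vocabulary (`Census/CertBits.lean`) -/

-- `Census.ofBits n w = ofBits n w` holds by `rfl`; as a named lemma it is
-- `Summit.Ventures.QEC.Decoders.census_ofBits_eq` (type-08, `Decoders/RadiusCheck.lean`).

/-- The checker's `Census.popc` IS `bitCount` (same structural recursion). [folklore] -/
theorem census_popc_eq_bitCount : ∀ n w : ℕ, Census.popc n w = bitCount n w
  | 0, _ => rfl
  | n + 1, w => by rw [Census.popc, bitCount, census_popc_eq_bitCount n]

/-- The checker's `Census.rowMatrix n rows` IS `ofBitRows n (fun r => rows[r])`. [folklore] -/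
theorem census_rowMatrix_eq_ofBitRows (n : ℕ) (rows : List ℕ) :
    Census.rowMatrix n rows = ofBitRows n (fun r : Fin rows.length => rows[r]) := rfl

/-- The checker's syndrome test `Census.synZero n H v` ↔ `ofBitRows n H · ofBits n v = 0`.
[folklore] -/
theorem census_synZero_iff_mulVec (n : ℕ) (H : List ℕ) (v : ℕ) :
    Census.synZero n H v = true ↔ ofBitRows n (fun r : Fin H.length => H[r]) *ᵥ ofBits n v = 0 := by
  rw [mulVec_ofBitRows_eq_zero_iff, Census.synZero, List.all_eq_true]
  simp only [census_popc_eq_bitCount, beq_iff_eq]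
  constructor
  · intro h r; exact h _ (List.getElem_mem r.is_lt)
  · intro h x hx
    obtain ⟨r, hr, rfl⟩ := List.getElem_of_mem hx
    exact h ⟨r, hr⟩

end Summit.Ventures.QEC
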